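import Mathlib.MeasureTheory.Constructions.Cylinders
import Mathlib.MeasureTheory.Function.ContinuousMapDense
import Mathlib.MeasureTheory.Integral.Bochner.Set

/-!
# Entropy bound for tangent states, V: continuous cylinder functions are dense in `L¹` (line `FirstLemma`, crux stmt-AtomisticToContinuum-14135)

Helper file of the registered stub `stub_tangentEntropyBoundUniform` (`…KiferEntropyBoundAffinity.lean`), namespace
`Summit.AtomisticToContinuum.HydrodynamicLimit.Theorems.KiferCompactification`; companion of `…KiferEntropyLsc.lean`
(lower semicontinuity of `KL` along a DENSE test class). It supplies the density hypothesis `hdense` of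
`stub_klDiv_lsc_of_denseClass` for the test class of a family of real coordinates `T i : Ω → ℝ` (for point processes:
the linear statistics `ω ↦ ∑_{p ∈ ω} f p`, `f ∈ C_c`): `stub_cylinderDenseL1` (REGISTERED helper stub) — every `ψ`
measurable for the σ-algebra GENERATED by the `T i` with `|ψ| ≤ C` is, for every finite measure `ν` and `ε > 0`, `ε`-close
in `L¹(ν)` to a CONTINUOUS CYLINDER FUNCTION `ω ↦ g (T i ω)_{i ∈ s}` (`s` finite, `g : ℝ^s → ℝ` continuous) with the same
bound. Proof: Dynkin induction over Mathlib's `measurableCylinders` of `ℝ^ι` pulled back along `ω ↦ (T i ω)_i`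
(finite-dimensional events by `Integrable.exists_boundedContinuous_integral_sub_le` on `ℝ^s`, complements, countable
disjoint unions by a tail cut and clamping), then the quantisation `ψ + C ≈ δ ∑_{j=1}^{M} 𝟙{ψ + C ≥ jδ}` and clamping to
`[-C, C]`. No new definitions (the functional monotone class theorem in `L¹` form; Kallenberg 2002, Lemma 1.37).
-/

noncomputable section

open MeasureTheory Set Filter Topology Function
open scoped ENNReal

namespace Summit.AtomisticToContinuum.HydrodynamicLimit.Theorems.KiferCompactification

variable {Ω : Type*} [MeasurableSpace Ω] {ι : Type*}

/-- Clamping to an interval containing `t` does not increase the distance to `t`. -/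
private theorem abs_sub_clamp_le {a b t x : ℝ} (hat : a ≤ t) (htb : t ≤ b) :
    |t - max a (min b x)| ≤ |t - x| := by
  rcases le_total x a with hxa | hxa
  · have h : max a (min b x) = a := max_eq_left ((min_le_right _ _).trans hxa)
    rw [h, abs_of_nonneg (sub_nonneg.2 hat), abs_of_nonneg (by linarith)]
    linarith
  rcases le_total b x with hbx | hbx
  · have h : max a (min b x) = b := by rw [min_eq_left hbx, max_eq_right (hat.trans htb)]
    rw [h, abs_of_nonpos (sub_nonpos.2 htb), abs_of_nonpos (by linarith)]
    linarith
  · have h : max a (min b x) = x := by rw [min_eq_right hbx, max_eq_right hxa]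
    rw [h]

/-- Uniform quantisation by superlevel indicators: for `δ > 0`, `0 ≤ t` and `t / δ ≤ M`,
`|t - δ ∑_{j=1}^{M} 𝟙{j δ ≤ t}| ≤ δ` (the sum counts `⌊t/δ⌋` thresholds). -/
private theorem abs_sub_mul_sum_indicator_le {δ t : ℝ} (hδ : 0 < δ) (ht : 0 ≤ t) {M : ℕ} (hM : t / δ ≤ M) :
    |t - δ * ∑ j ∈ Finset.Icc 1 M, (Ici ((j : ℝ) * δ)).indicator (1 : ℝ → ℝ) t| ≤ δ := by
  classical
  have hind : ∀ j : ℕ, (Ici ((j : ℝ) * δ)).indicator (1 : ℝ → ℝ) t = if (j : ℝ) * δ ≤ t then 1 else 0 := by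
    intro j; simp only [indicator_apply, mem_Ici, Pi.one_apply]
  simp_rw [hind]
  rw [Finset.sum_boole]
  have hfilter : (Finset.Icc 1 M).filter (fun j : ℕ => (j : ℝ) * δ ≤ t) = Finset.Icc 1 ⌊t / δ⌋₊ := by
    ext j
    simp only [Finset.mem_filter, Finset.mem_Icc]
    have hiff : (j : ℝ) * δ ≤ t ↔ j ≤ ⌊t / δ⌋₊ := by
      rw [Nat.le_floor_iff (div_nonneg ht hδ.le), le_div_iff₀ hδ]
    have hfl : ⌊t / δ⌋₊ ≤ M := by
      have h1 : (⌊t / δ⌋₊ : ℝ) ≤ M := (Nat.floor_le (div_nonneg ht hδ.le)).trans hM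
      exact_mod_cast h1
    constructor
    · rintro ⟨⟨h1, -⟩, h3⟩; exact ⟨h1, hiff.1 h3⟩
    · rintro ⟨h1, h2⟩; exact ⟨⟨h1, h2.trans hfl⟩, hiff.2 h2⟩
  rw [hfilter, Nat.card_Icc, Nat.add_sub_cancel]
  have h1 : (⌊t / δ⌋₊ : ℝ) * δ ≤ t := (le_div_iff₀ hδ).1 (Nat.floor_le (div_nonneg ht hδ.le))
  have h2 : t < (⌊t / δ⌋₊ + 1) * δ := (div_lt_iff₀ hδ).1 (Nat.lt_floor_add_one _)
  rw [abs_le]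
  constructor <;> nlinarith

/-! ## Continuous cylinder functions of finitely many coordinates -/

section Cylinder

variable (T : ι → Ω → ℝ)

/-- A continuous cylinder function is measurable (finite coordinate vectors are measurable). -/
private theorem measurable_cylFun (hT : ∀ i, Measurable (T i)) {s : Finset ι} {g : (↥s → ℝ) → ℝ}
    (hg : Continuous g) : Measurable fun ω => g (fun i : ↥s => T i ω) :=
  hg.measurable.comp (measurable_pi_lambda _ fun i => hT i)

omit [MeasurableSpace Ω] in
/-- Two continuous cylinder functions combine through a continuous binary operation into one. -/
private theorem exists_cylFun_comp₂ {F : ℝ → ℝ → ℝ} (hF : Continuous fun p : ℝ × ℝ => F p.1 p.2)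
    {s₁ s₂ : Finset ι} {g₁ : (↥s₁ → ℝ) → ℝ} {g₂ : (↥s₂ → ℝ) → ℝ} (hg₁ : Continuous g₁) (hg₂ : Continuous g₂) :
    ∃ (s : Finset ι) (g : (↥s → ℝ) → ℝ), Continuous g ∧
      ∀ ω, g (fun i : ↥s => T i ω) = F (g₁ fun i : ↥s₁ => T i ω) (g₂ fun i : ↥s₂ => T i ω) := by
  classical
  refine ⟨s₁ ∪ s₂, fun v => F (g₁ fun i : ↥s₁ => v ⟨i, Finset.mem_union_left _ i.2⟩)
    (g₂ fun i : ↥s₂ => v ⟨i, Finset.mem_union_right _ i.2⟩), ?_, fun ω => rfl⟩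
  exact hF.comp ((hg₁.comp (continuous_pi fun i => continuous_apply _)).prodMk
    (hg₂.comp (continuous_pi fun i => continuous_apply _)))

omit [MeasurableSpace Ω] in
/-- Finite sums of continuous cylinder functions are continuous cylinder functions. -/
private theorem exists_cylFun_sum {κ : Type*} (I : Finset κ) (s : κ → Finset ι) (g : ∀ k, (↥(s k) → ℝ) → ℝ)
    (hg : ∀ k, Continuous (g k)) :
    ∃ (s' : Finset ι) (G : (↥s' → ℝ) → ℝ), Continuous G ∧
      ∀ ω, G (fun i : ↥s' => T i ω) = ∑ k ∈ I, g k (fun i : ↥(s k) => T i ω) := by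
  classical
  induction I using Finset.induction_on with
  | empty => exact ⟨∅, fun _ => 0, continuous_const, fun ω => by simp⟩
  | insert a I ha ih =>
    obtain ⟨s', G, hG, hGeq⟩ := ih
    obtain ⟨s'', G', hG', hG'eq⟩ := exists_cylFun_comp₂ T (F := fun x y => x + y) continuous_add (hg a) hG
    refine ⟨s'', G', hG', fun ω => ?_⟩
    rw [hG'eq, hGeq, Finset.sum_insert ha]

/-- Indicators of pulled-back events are integrable. -/
private theorem integrable_indicator_comp (ν : Measure Ω) [IsFiniteMeasure ν] {Φ : Ω → (ι → ℝ)} (hΦ : Measurable Φ)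
    {E : Set (ι → ℝ)} (hE : MeasurableSet E) : Integrable (fun ω => E.indicator (1 : (ι → ℝ) → ℝ) (Φ ω)) ν := by
  rw [show (fun ω => E.indicator (1 : (ι → ℝ) → ℝ) (Φ ω)) = (Φ ⁻¹' E).indicator 1 from funext fun ω => rfl]
  exact (integrable_const (1 : ℝ)).indicator (hΦ hE)

/-- Bounded continuous cylinder functions are integrable. -/
private theorem integrable_cylFun (hT : ∀ i, Measurable (T i)) (ν : Measure Ω) [IsFiniteMeasure ν] {s : Finset ι}
    {g : (↥s → ℝ) → ℝ} (hg : Continuous g) {C : ℝ} (hC : ∀ ω, |g (fun i : ↥s => T i ω)| ≤ C) :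
    Integrable (fun ω => g (fun i : ↥s => T i ω)) ν :=
  Integrable.of_bound (measurable_cylFun T hT hg).aestronglyMeasurable C
    (ae_of_all _ fun ω => by rw [Real.norm_eq_abs]; exact hC ω)

/-- Finite-dimensional cylinder events: by density of bounded continuous functions in `L¹` of the finite Borel measure
`(T_s)_* ν` on `ℝ^s`, then clamping to `[0, 1]`. -/
private theorem exists_cylFun_approx_indicator_fin (hT : ∀ i, Measurable (T i)) (ν : Measure Ω) [IsFiniteMeasure ν]
    (s : Finset ι) {S : Set (↥s → ℝ)} (hS : MeasurableSet S) {ε : ℝ} (hε : 0 < ε) :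
    ∃ g : (↥s → ℝ) → ℝ, Continuous g ∧ (∀ v, 0 ≤ g v ∧ g v ≤ 1) ∧
      ∫ ω, |S.indicator 1 (fun i : ↥s => T i ω) - g (fun i : ↥s => T i ω)| ∂ν ≤ ε := by
  set ρ : Measure (↥s → ℝ) := ν.map (fun ω (i : ↥s) => T i ω) with hρ
  have hf : Integrable (S.indicator (1 : (↥s → ℝ) → ℝ)) ρ := (integrable_const (1 : ℝ)).indicator hS
  obtain ⟨g, hg, hgi⟩ := hf.exists_boundedContinuous_integral_sub_le hε
  refine ⟨fun v => max 0 (min 1 (g v)), continuous_const.max (continuous_const.min g.continuous),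
    fun v => ⟨le_max_left _ _, max_le zero_le_one (min_le_left _ _)⟩, ?_⟩
  have hclm : Measurable fun v : ↥s → ℝ => max 0 (min 1 (g v)) :=
    (continuous_const.max (continuous_const.min g.continuous)).measurable
  have hindm : Measurable (S.indicator (1 : (↥s → ℝ) → ℝ)) := measurable_const.indicator hS
  have hmeas : Measurable fun v : ↥s → ℝ => |S.indicator (1 : (↥s → ℝ) → ℝ) v - max 0 (min 1 (g v))| :=
    continuous_abs.measurable.comp (hindm.sub hclm)
  calc ∫ ω, |S.indicator 1 (fun i : ↥s => T i ω) - max 0 (min 1 (g fun i : ↥s => T i ω))| ∂ν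
      = ∫ v, |S.indicator 1 v - max 0 (min 1 (g v))| ∂ρ := by
        rw [hρ, integral_map (measurable_pi_lambda (fun ω (i : ↥s) => T i ω) fun i => hT i).aemeasurable
          hmeas.aestronglyMeasurable]
    _ ≤ ∫ v, ‖S.indicator 1 v - g v‖ ∂ρ := by
        refine integral_mono_of_nonneg (ae_of_all _ fun v => abs_nonneg _) (hf.sub hgi).norm
          (ae_of_all _ fun v => ?_)
        dsimp only
        rw [Real.norm_eq_abs]
        have h01 : S.indicator (1 : (↥s → ℝ) → ℝ) v ∈ Icc (0 : ℝ) 1 := by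
          by_cases hv : v ∈ S <;> simp [hv]
        exact abs_sub_clamp_le h01.1 h01.2
    _ ≤ ε := hg

/-- Pointwise bookkeeping for countable disjoint unions: cutting the union at `n` and clamping the sum of the
approximants to `[0, 1]`. -/
private theorem abs_indicator_iUnion_sub_clamp_le {X : Type*} {f : ℕ → Set X} (hdisj : Pairwise (Disjoint on f))
    (n : ℕ) (x : X) (b : ℕ → ℝ) :
    |(⋃ i, f i).indicator (1 : X → ℝ) x - max 0 (min 1 (∑ i ∈ Finset.Iic n, b i))| ≤
      ((⋃ i, f i) \ Set.accumulate f n).indicator (1 : X → ℝ) x +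
        ∑ i ∈ Finset.Iic n, |(f i).indicator (1 : X → ℝ) x - b i| := by
  have hacc : Set.accumulate f n = ⋃ i ∈ Finset.Iic n, f i := by
    ext y; simp only [Set.mem_accumulate, mem_iUnion, Finset.mem_Iic, exists_prop]
  have hsum : (Set.accumulate f n).indicator (1 : X → ℝ) x = ∑ i ∈ Finset.Iic n, (f i).indicator (1 : X → ℝ) x := by
    rw [hacc]
    exact Finset.indicator_biUnion_apply _ _ (hdisj.set_pairwise _) x
  have hnn : 0 ≤ ∑ i ∈ Finset.Iic n, |(f i).indicator (1 : X → ℝ) x - b i| :=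
    Finset.sum_nonneg fun i _ => abs_nonneg _
  by_cases hx : x ∈ Set.accumulate f n
  · have hxU : x ∈ ⋃ i, f i := Set.accumulate_subset_iUnion n hx
    rw [indicator_of_mem hxU, indicator_of_notMem (fun h => h.2 hx), zero_add, Pi.one_apply]
    calc |(1 : ℝ) - max 0 (min 1 (∑ i ∈ Finset.Iic n, b i))| ≤ |1 - ∑ i ∈ Finset.Iic n, b i| :=
          abs_sub_clamp_le zero_le_one le_rfl
      _ = |∑ i ∈ Finset.Iic n, ((f i).indicator (1 : X → ℝ) x - b i)| := by
          rw [Finset.sum_sub_distrib, ← hsum, indicator_of_mem hx, Pi.one_apply]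
      _ ≤ ∑ i ∈ Finset.Iic n, |(f i).indicator (1 : X → ℝ) x - b i| := Finset.abs_sum_le_sum_abs _ _
  · have h3 : ∀ i ∈ Finset.Iic n, (f i).indicator (1 : X → ℝ) x = 0 := by
      intro i hi
      refine indicator_of_notMem (fun hxi => hx ?_) _
      exact Set.mem_accumulate.2 ⟨i, Finset.mem_Iic.1 hi, hxi⟩
    have hc : max 0 (min 1 (∑ i ∈ Finset.Iic n, b i)) ∈ Icc (0 : ℝ) 1 :=
      ⟨le_max_left _ _, max_le zero_le_one (min_le_left _ _)⟩
    by_cases hxU : x ∈ ⋃ i, f i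
    · rw [indicator_of_mem hxU, indicator_of_mem (show x ∈ (⋃ i, f i) \ Set.accumulate f n from ⟨hxU, hx⟩),
        Pi.one_apply]
      have h4 : |(1 : ℝ) - max 0 (min 1 (∑ i ∈ Finset.Iic n, b i))| ≤ 1 := by
        rw [abs_le]; constructor <;> linarith [hc.1, hc.2]
      linarith
    · rw [indicator_of_notMem hxU, indicator_of_notMem (fun h => hxU h.1), zero_add]
      calc |(0 : ℝ) - max 0 (min 1 (∑ i ∈ Finset.Iic n, b i))| ≤ |0 - ∑ i ∈ Finset.Iic n, b i| :=
            abs_sub_clamp_le le_rfl zero_le_one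
        _ = |∑ i ∈ Finset.Iic n, ((f i).indicator (1 : X → ℝ) x - b i)| := by
            rw [Finset.sum_sub_distrib, Finset.sum_eq_zero h3]
        _ ≤ ∑ i ∈ Finset.Iic n, |(f i).indicator (1 : X → ℝ) x - b i| := Finset.abs_sum_le_sum_abs _ _

/-- **Indicators of events generated by the coordinates are `L¹`-approximable by `[0, 1]`-valued continuous cylinder
functions**: for every event `E` of the product σ-algebra of `ℝ^ι`, the indicator of `{ω | (T i ω)_i ∈ E}` is within `ε`
in `L¹(ν)` of some `ω ↦ g (T i ω)_{i ∈ s}`, `g` continuous with values in `[0, 1]` (Dynkin induction over cylinders). -/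
private theorem exists_cylFun_approx_indicator (hT : ∀ i, Measurable (T i)) (ν : Measure Ω) [IsFiniteMeasure ν]
    {E : Set (ι → ℝ)} (hE : MeasurableSet E) {ε : ℝ} (hε : 0 < ε) :
    ∃ (s : Finset ι) (g : (↥s → ℝ) → ℝ), Continuous g ∧ (∀ v, 0 ≤ g v ∧ g v ≤ 1) ∧
      ∫ ω, |E.indicator 1 (fun i => T i ω) - g (fun i : ↥s => T i ω)| ∂ν ≤ ε := by
  have hΦ : Measurable fun (ω : Ω) (i : ι) => T i ω := measurable_pi_lambda _ fun i => hT i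
  induction E, hE using MeasurableSpace.induction_on_inter generateFrom_measurableCylinders.symm
    isPiSystem_measurableCylinders generalizing ε with
  | empty =>
    refine ⟨∅, fun _ => 0, continuous_const, fun v => ⟨le_rfl, zero_le_one⟩, ?_⟩
    simp only [indicator_empty, sub_zero, abs_zero, integral_zero]
    exact hε.le
  | basic t ht =>
    obtain ⟨s, S, hS, rfl⟩ := (mem_measurableCylinders t).1 ht
    obtain ⟨g, hg, hg01, hgε⟩ := exists_cylFun_approx_indicator_fin T hT ν s hS hε
    refine ⟨s, g, hg, hg01, ?_⟩
    have hind : ∀ ω, (cylinder s S).indicator (1 : (ι → ℝ) → ℝ) (fun i => T i ω) =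
        S.indicator (1 : (↥s → ℝ) → ℝ) (fun i : ↥s => T i ω) := by
      intro ω
      have hmem : (fun i => T i ω) ∈ cylinder s S ↔ (fun i : ↥s => T i ω) ∈ S := Iff.rfl
      by_cases h : (fun i : ↥s => T i ω) ∈ S
      · rw [indicator_of_mem h, indicator_of_mem (hmem.2 h)]; rfl
      · rw [indicator_of_notMem h, indicator_of_notMem (mt hmem.1 h)]
    simp_rw [hind]
    exact hgε
  | compl t htm ih =>
    obtain ⟨s, g, hg, hg01, hgε⟩ := ih hε
    refine ⟨s, fun v => 1 - g v, continuous_const.sub hg,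
      fun v => ⟨sub_nonneg.2 (hg01 v).2, by linarith [(hg01 v).1]⟩, ?_⟩
    have heq : ∀ ω, |tᶜ.indicator (1 : (ι → ℝ) → ℝ) (fun i => T i ω) - (1 - g fun i : ↥s => T i ω)| =
        |t.indicator (1 : (ι → ℝ) → ℝ) (fun i => T i ω) - g fun i : ↥s => T i ω| := by
      intro ω
      rw [indicator_compl, Pi.sub_apply, Pi.one_apply, abs_sub_comm]
      congr 1
      ring
    simp_rw [heq]
    exact hgε
  | iUnion f hdisj hfm ih =>
    set ρ : Measure (ι → ℝ) := ν.map (fun ω i => T i ω) with hρ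
    -- cut the union at `n`
    have htend : Tendsto (fun n => ρ.real (Set.accumulate f n)) atTop (𝓝 (ρ.real (⋃ i, f i))) :=
      (ENNReal.tendsto_toReal (measure_ne_top ρ _)).comp tendsto_measure_iUnion_accumulate
    obtain ⟨n, hn⟩ : ∃ n, ρ.real (⋃ i, f i) - ρ.real (Set.accumulate f n) ≤ ε / 2 := by
      obtain ⟨N, hN⟩ := Metric.tendsto_atTop.1 htend (ε / 2) (by positivity)
      exact ⟨N, by have h := hN N le_rfl; rw [Real.dist_eq, abs_lt] at h; linarith [h.1]⟩
    have hacc_m : MeasurableSet (Set.accumulate f n) :=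
      MeasurableSet.iUnion fun i => MeasurableSet.iUnion fun _ => hfm i
    have htail : ρ.real ((⋃ i, f i) \ Set.accumulate f n) ≤ ε / 2 := by
      rw [measureReal_sdiff (Set.accumulate_subset_iUnion n) hacc_m]; exact hn
    -- approximants of the pieces `f i`, `i ≤ n`
    have hη : 0 < ε / (2 * ((n : ℝ) + 1)) := by positivity
    choose s g hg hg01 hgε using fun i => ih i hη
    obtain ⟨s', G, hG, hGeq⟩ := exists_cylFun_sum T (Finset.Iic n) s g hg
    refine ⟨s', fun v => max 0 (min 1 (G v)), continuous_const.max (continuous_const.min hG),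
      fun v => ⟨le_max_left _ _, max_le zero_le_one (min_le_left _ _)⟩, ?_⟩
    -- integrability bookkeeping
    have hint_i : ∀ i, Integrable (fun ω => |(f i).indicator (1 : (ι → ℝ) → ℝ) (fun i => T i ω) -
        g i (fun j : ↥(s i) => T j ω)|) ν := fun i =>
      ((integrable_indicator_comp ν hΦ (hfm i)).sub (integrable_cylFun T hT ν (hg i) (C := 1) fun ω =>
        abs_le.2 ⟨by linarith [(hg01 i (fun j : ↥(s i) => T j ω)).1], (hg01 i _).2⟩)).abs
    have htail_fun : ∀ ω, ((⋃ i, f i) \ Set.accumulate f n).indicator (1 : (ι → ℝ) → ℝ) (fun i => T i ω) =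
        ((fun ω i => T i ω) ⁻¹' ((⋃ i, f i) \ Set.accumulate f n)).indicator (1 : Ω → ℝ) ω := fun ω => rfl
    have htail_m : MeasurableSet ((fun ω i => T i ω) ⁻¹' ((⋃ i, f i) \ Set.accumulate f n)) :=
      hΦ ((MeasurableSet.iUnion hfm).diff hacc_m)
    have hint_tail : Integrable (fun ω => ((⋃ i, f i) \ Set.accumulate f n).indicator (1 : (ι → ℝ) → ℝ)
        (fun i => T i ω)) ν := integrable_indicator_comp ν hΦ ((MeasurableSet.iUnion hfm).diff hacc_m)
    -- the estimate
    calc ∫ ω, |(⋃ i, f i).indicator (1 : (ι → ℝ) → ℝ) (fun i => T i ω) - max 0 (min 1 (G fun i : ↥s' => T i ω))| ∂ν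
        ≤ ∫ ω, (((⋃ i, f i) \ Set.accumulate f n).indicator (1 : (ι → ℝ) → ℝ) (fun i => T i ω) +
            ∑ i ∈ Finset.Iic n, |(f i).indicator (1 : (ι → ℝ) → ℝ) (fun i => T i ω) -
              g i (fun j : ↥(s i) => T j ω)|) ∂ν := by
          refine integral_mono_of_nonneg (ae_of_all _ fun ω => abs_nonneg _)
            (hint_tail.add (integrable_finsetSum _ fun i _ => hint_i i)) (ae_of_all _ fun ω => ?_)
          dsimp only
          rw [hGeq ω]
          exact abs_indicator_iUnion_sub_clamp_le hdisj n _ _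
      _ = ρ.real ((⋃ i, f i) \ Set.accumulate f n) +
            ∑ i ∈ Finset.Iic n, ∫ ω, |(f i).indicator (1 : (ι → ℝ) → ℝ) (fun i => T i ω) -
              g i (fun j : ↥(s i) => T j ω)| ∂ν := by
          rw [integral_add hint_tail (integrable_finsetSum _ fun i _ => hint_i i),
            integral_finsetSum _ fun i _ => hint_i i]
          congr 1
          simp_rw [htail_fun]
          rw [integral_indicator_one htail_m, hρ, map_measureReal_apply hΦ ((MeasurableSet.iUnion hfm).diff hacc_m)]
      _ ≤ ε / 2 + ∑ _i ∈ Finset.Iic n, ε / (2 * ((n : ℝ) + 1)) :=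
          add_le_add htail (Finset.sum_le_sum fun i _ => hgε i)
      _ = ε := by
          rw [Finset.sum_const, Nat.card_Iic, nsmul_eq_mul]
          push_cast
          field_simp
          ring

/-- **Continuous cylinder functions are dense in `L¹` among bounded functions measurable for the generated σ-algebra**
(registered helper stub of line `FirstLemma`; the functional monotone class theorem in `L¹` form): for measurable
`T i : Ω → ℝ`, `ψ` measurable for the σ-algebra generated by the `T i` with `|ψ| ≤ C`, a finite measure `ν` and `ε > 0`,
there are a finite `s ⊆ ι` and a continuous `g : ℝ^s → ℝ` with `|g (T i ω)_{i ∈ s}| ≤ C` and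
`∫ |ψ ω - g (T i ω)_{i ∈ s}| dν ≤ ε` (indicators by `exists_cylFun_approx_indicator`, quantisation, clamping). -/
theorem stub_cylinderDenseL1 {Ω : Type*} [MeasurableSpace Ω] {ι : Type*} (T : ι → Ω → ℝ)
    (hT : ∀ i, Measurable (T i)) (ν : Measure Ω) [IsFiniteMeasure ν] {ψ : Ω → ℝ}
    (hψ : Measurable[⨆ i, MeasurableSpace.comap (T i) inferInstance] ψ) {C : ℝ} (hC : ∀ x, |ψ x| ≤ C)
    {ε : ℝ} (hε : 0 < ε) :
    ∃ (s : Finset ι) (g : (↥s → ℝ) → ℝ), Continuous g ∧ (∀ x : Ω, |g (fun i : ↥s => T i x)| ≤ C) ∧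
      ∫ x, |ψ x - g (fun i : ↥s => T i x)| ∂ν ≤ ε := by
  -- the generated σ-algebra is the pull-back of the product σ-algebra
  set Φ : Ω → (ι → ℝ) := fun ω i => T i ω with hΦdef
  have hΦ : Measurable Φ := measurable_pi_lambda _ fun i => hT i
  have hm : (⨆ i, MeasurableSpace.comap (T i) inferInstance : MeasurableSpace Ω) =
      MeasurableSpace.comap Φ MeasurableSpace.pi := by
    rw [show (MeasurableSpace.pi : MeasurableSpace (ι → ℝ)) = ⨆ i, MeasurableSpace.comap (fun b : ι → ℝ => b i)
      inferInstance from rfl, MeasurableSpace.comap_iSup]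
    simp_rw [MeasurableSpace.comap_comp]
    rfl
  rw [hm] at hψ
  -- quantisation scale
  set δ : ℝ := ε / (2 * (ν.real univ + 1)) with hδdef
  have hδ : 0 < δ := by positivity
  have hδν : δ * ν.real univ ≤ ε / 2 := by
    rw [hδdef, div_mul_eq_mul_div, div_le_div_iff₀ (by positivity) (by positivity)]
    nlinarith [measureReal_nonneg (μ := ν) (s := univ), hε]
  set M : ℕ := ⌈2 * C / δ⌉₊ with hMdef
  -- the superlevel events `B j = {jδ ≤ ψ + C}` and their product-space representatives
  have hψC : Measurable[MeasurableSpace.comap Φ MeasurableSpace.pi] fun ω => ψ ω + C := hψ.add_const C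
  have hB : ∀ j : ℕ, ∃ E : Set (ι → ℝ), MeasurableSet E ∧
      Φ ⁻¹' E = (fun ω => ψ ω + C) ⁻¹' Ici ((j : ℝ) * δ) := fun j =>
    MeasurableSpace.measurableSet_comap.1 (hψC measurableSet_Ici)
  choose E hEm hEeq using hB
  -- approximants of the indicators
  have hη : 0 < ε / (2 * (δ * M + 1)) := by positivity
  choose s g hg hg01 hgε using fun j => exists_cylFun_approx_indicator T hT ν (hEm j) hη
  obtain ⟨s', G, hG, hGeq⟩ := exists_cylFun_sum T (Finset.Icc 1 M) s (fun j v => δ * g j v)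
    fun j => continuous_const.mul (hg j)
  refine ⟨s', fun v => max (-C) (min C (-C + G v)),
    continuous_const.max (continuous_const.min (continuous_const.add hG)), fun x => ?_, ?_⟩
  · -- the bound `C` (note `0 ≤ C` as soon as `Ω` is inhabited)
    have hC0 : 0 ≤ C := (abs_nonneg _).trans (hC x)
    rw [abs_le]
    exact ⟨le_max_left _ _, max_le (by linarith) (min_le_left _ _)⟩
  -- indicator identities
  have hind : ∀ j ω, (E j).indicator (1 : (ι → ℝ) → ℝ) (fun i => T i ω) =
      (Ici ((j : ℝ) * δ)).indicator (1 : ℝ → ℝ) (ψ ω + C) := by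
    intro j ω
    have hmem : (fun i => T i ω) ∈ E j ↔ ψ ω + C ∈ Ici ((j : ℝ) * δ) := by
      change ω ∈ Φ ⁻¹' E j ↔ ω ∈ (fun ω => ψ ω + C) ⁻¹' Ici ((j : ℝ) * δ)
      rw [hEeq j]
    by_cases h : (fun i => T i ω) ∈ E j
    · rw [indicator_of_mem h, indicator_of_mem (hmem.1 h)]; rfl
    · rw [indicator_of_notMem h, indicator_of_notMem (mt hmem.2 h)]
  -- pointwise estimate
  have hpt : ∀ ω, |ψ ω - max (-C) (min C (-C + G fun i : ↥s' => T i ω))| ≤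
      δ + δ * ∑ j ∈ Finset.Icc 1 M, |(E j).indicator (1 : (ι → ℝ) → ℝ) (fun i => T i ω) -
        g j (fun i : ↥(s j) => T i ω)| := by
    intro ω
    have hωC := abs_le.1 (hC ω)
    have h1 : |ψ ω - max (-C) (min C (-C + G fun i : ↥s' => T i ω))| ≤
        |ψ ω - (-C + G fun i : ↥s' => T i ω)| := abs_sub_clamp_le hωC.1 hωC.2
    have h2 : |(ψ ω + C) - δ * ∑ j ∈ Finset.Icc 1 M, (Ici ((j : ℝ) * δ)).indicator (1 : ℝ → ℝ) (ψ ω + C)| ≤ δ := by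
      refine abs_sub_mul_sum_indicator_le hδ (by linarith) ?_
      rw [hMdef]
      refine (div_le_div_of_nonneg_right (by linarith) hδ.le).trans (Nat.le_ceil _)
    have h3 : |δ * ∑ j ∈ Finset.Icc 1 M, (Ici ((j : ℝ) * δ)).indicator (1 : ℝ → ℝ) (ψ ω + C) -
        G (fun i : ↥s' => T i ω)| ≤ δ * ∑ j ∈ Finset.Icc 1 M,
          |(E j).indicator (1 : (ι → ℝ) → ℝ) (fun i => T i ω) - g j (fun i : ↥(s j) => T i ω)| := by
      rw [hGeq ω, Finset.mul_sum, ← Finset.sum_sub_distrib, Finset.mul_sum]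
      refine (Finset.abs_sum_le_sum_abs _ _).trans (le_of_eq (Finset.sum_congr rfl fun j _ => ?_))
      rw [← hind j ω, ← mul_sub, abs_mul, abs_of_pos hδ]
    calc |ψ ω - max (-C) (min C (-C + G fun i : ↥s' => T i ω))|
        ≤ |ψ ω - (-C + G fun i : ↥s' => T i ω)| := h1
      _ ≤ |(ψ ω + C) - δ * ∑ j ∈ Finset.Icc 1 M, (Ici ((j : ℝ) * δ)).indicator (1 : ℝ → ℝ) (ψ ω + C)| +
          |δ * ∑ j ∈ Finset.Icc 1 M, (Ici ((j : ℝ) * δ)).indicator (1 : ℝ → ℝ) (ψ ω + C) -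
            G (fun i : ↥s' => T i ω)| := by
          have := abs_sub_le (ψ ω + C)
            (δ * ∑ j ∈ Finset.Icc 1 M, (Ici ((j : ℝ) * δ)).indicator (1 : ℝ → ℝ) (ψ ω + C))
            (G fun i : ↥s' => T i ω)
          have heq : ψ ω - (-C + G fun i : ↥s' => T i ω) = (ψ ω + C) - G (fun i : ↥s' => T i ω) := by ring
          rw [heq]; exact this
      _ ≤ _ := add_le_add h2 h3
  -- integrability bookkeeping
  have hint_j : ∀ j, Integrable (fun ω => |(E j).indicator (1 : (ι → ℝ) → ℝ) (fun i => T i ω) -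
      g j (fun i : ↥(s j) => T i ω)|) ν := fun j =>
    ((integrable_indicator_comp ν hΦ (hEm j)).sub (integrable_cylFun T hT ν (hg j) (C := 1) fun ω =>
      abs_le.2 ⟨by linarith [(hg01 j (fun i : ↥(s j) => T i ω)).1], (hg01 j _).2⟩)).abs
  -- the estimate
  calc ∫ ω, |ψ ω - max (-C) (min C (-C + G fun i : ↥s' => T i ω))| ∂ν
      ≤ ∫ ω, (δ + δ * ∑ j ∈ Finset.Icc 1 M, |(E j).indicator (1 : (ι → ℝ) → ℝ) (fun i => T i ω) -
          g j (fun i : ↥(s j) => T i ω)|) ∂ν :=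
        integral_mono_of_nonneg (ae_of_all _ fun ω => abs_nonneg _) ((integrable_const δ).add
          ((integrable_finsetSum _ fun j _ => hint_j j).const_mul δ)) (ae_of_all _ hpt)
    _ = δ * ν.real univ + δ * ∑ j ∈ Finset.Icc 1 M, ∫ ω, |(E j).indicator (1 : (ι → ℝ) → ℝ) (fun i => T i ω) -
          g j (fun i : ↥(s j) => T i ω)| ∂ν := by
        rw [integral_add (integrable_const δ) ((integrable_finsetSum _ fun j _ => hint_j j).const_mul δ),
          integral_const, smul_eq_mul, mul_comm, integral_const_mul, integral_finsetSum _ fun j _ => hint_j j]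
    _ ≤ ε / 2 + δ * ∑ _j ∈ Finset.Icc 1 M, ε / (2 * (δ * M + 1)) :=
        add_le_add hδν (mul_le_mul_of_nonneg_left (Finset.sum_le_sum fun j _ => hgε j) hδ.le)
    _ ≤ ε / 2 + ε / 2 := by
        gcongr
        rw [Finset.sum_const, Nat.card_Icc, Nat.add_sub_cancel, nsmul_eq_mul, ← mul_assoc,
          mul_div_assoc', div_le_div_iff₀ (by positivity) (by positivity)]
        nlinarith [hδ, hε, (Nat.cast_nonneg M : (0 : ℝ) ≤ M)]
    _ = ε := by ring

end Cylinder

end Summit.AtomisticToContinuum.HydrodynamicLimit.Theorems.KiferCompactification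

end
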